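import Mathlib
import Summits.KontsevichZagierPeriods.KontsevichZagierPeriods.Theorems.InverseLandauTateLiftingPullback
import Summits.KontsevichZagierPeriods.KontsevichZagierPeriods.Theorems.InverseLandauTateLiftingProdSplit
import Summits.KontsevichZagierPeriods.KontsevichZagierPeriods.Theorems.InverseLandauTateLiftingFubiniReduction
import Summits.KontsevichZagierPeriods.KontsevichZagierPeriods.Theorems.InverseLandauTateLiftingLowDimAlgSector
import Literature.NumberTheory.Transcendental.KZRulesAssociator
import Literature.NumberTheory.Transcendental.KZSubcalculusInvariants
import Literature.NumberTheory.Transcendental.KZProductIdeal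

/-!
# `TateLifting` (stmt-KontsevichZagierPeriods-9129), line `Sketch` — stub 58 `ConeEngine`:
# the volume of a cone inside the rules

For a `ℚ`-semialgebraic base `σ ⊆ ℝⁿ` let
`Cone σ = {z ∈ ℝⁿ⁺¹ | 0 < z_n < 1, (z₀, …, z_{n-1}) / z_n ∈ σ}` (apex `0`, base `σ × {1}`). For the
integrand-`1` representation `r = [Cone σ, 1]` and the integrand-`1` representation `s = [σ, 1]`
we prove `(n+1)·[Cone σ, 1] − [σ, 1] ∈ KZ.relations` ("volume of a cone = base × height / (n+1)",
inside the Kontsevich–Zagier calculus, no transcendence input). Chain of moves: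

* (a) ONE change of variables (rule (2)) along `Φ (x, t) = (t·x, t)` from the product domain
  `σ × (0,1)` onto `Cone σ` (inverse `z ↦ (z' / z_n, z_n)`); its Jacobian matrix is upper
  triangular (`t` on the diagonal, `x` in the last column, `1` in the corner) with determinant
  `tⁿ`, so `[Cone σ, 1] ≡ [σ × (0,1), tⁿ]` (`tateLifting_pullback` constructs the honest source);
* (b) integer scaling is integrand additivity: `(n+1)·[σ × (0,1), tⁿ] ≡ [σ × (0,1), (n+1)tⁿ]`
  (`KZ.IntegralRep.of_constMul_nat_sub_nsmul_mem_relations`);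
* (c) product splitting (`tateLifting_prodSplit`): `[σ × (0,1), (n+1)tⁿ] ≡ [σ, 1] · [(0,1), (n+1)uⁿ]`;
* (d) `[(0,1), (n+1)uⁿ]` is a polynomial cube of value `∫₀¹ (n+1)uⁿ du = 1`, hence
  (`Fubini.cubePoly_toPoint`, `kzPeriodConjecture_dim_zero`, soundness) equivalent to the unit
  representation `[pt, 1]`;
* (e) `relations` is a two-sided ideal and `[pt, 1]` is a unit modulo relations
  (`KZ.of_mul_mem_relations`, `KZ.mul_of_unit_sub_mem_relations`).

References: M. Kontsevich, D. Zagier, *Periods* (2001), §1.2 rules (1), (2), §4.1.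
-/

noncomputable section

open MeasureTheory Set MvPolynomial
open Literature.NumberTheory.Transcendental
open Literature.ModelTheory.ExponentialFields (IsSemialgebraic)

namespace Summit.KontsevichZagierPeriods.InverseLandau

namespace Cone

variable {n : ℕ}

/-- **The Jacobian of the cone chart.** The map `Φ w = (w_n · w', w_n)` (`w = (w', w_n)`) has at
every point a derivative `L` with `det L = w_nⁿ`: its matrix is upper triangular with diagonal
`(w_n, …, w_n, 1)` and last column `(w', 1)`. [folklore] -/
theorem exists_hasFDerivAt_det (w : Fin (n + 1) → ℝ) :
    ∃ L : (Fin (n + 1) → ℝ) →L[ℝ] (Fin (n + 1) → ℝ),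
      HasFDerivAt (fun w : Fin (n + 1) → ℝ =>
        (Fin.snoc (fun k : Fin n => w (Fin.last n) * w (Fin.castSucc k)) (w (Fin.last n)) :
          Fin (n + 1) → ℝ)) L w ∧ L.det = w (Fin.last n) ^ n := by
  classical
  -- the Jacobian matrix: `w_n` on the diagonal, `w'` in the last column, `1` in the corner
  set M : Matrix (Fin (n + 1)) (Fin (n + 1)) ℝ := Matrix.of fun i j =>
    if j = Fin.last n then (if i = Fin.last n then (1 : ℝ) else w i)
    else (if i = j then w (Fin.last n) else 0) with hM
  have hne : ∀ k : Fin n, Fin.last n ≠ Fin.castSucc k := fun k => (Fin.castSucc_ne_last k).symm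
  have hmul : ∀ v : Fin (n + 1) → ℝ, M.mulVec v = Fin.snoc (fun k : Fin n =>
      w (Fin.last n) * v (Fin.castSucc k) + w (Fin.castSucc k) * v (Fin.last n))
      (v (Fin.last n)) := by
    intro v
    funext i
    induction i using Fin.lastCases with
    | last =>
      simp [hM, Matrix.mulVec, dotProduct, Fin.sum_univ_castSucc, Fin.castSucc_ne_last, hne]
    | cast k =>
      simp [hM, Matrix.mulVec, dotProduct, Fin.sum_univ_castSucc, Fin.castSucc_ne_last, ite_mul,
        Finset.sum_ite_eq]
  have hdet : M.det = w (Fin.last n) ^ n := by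
    have htri : M.BlockTriangular id := by
      intro i j hij
      have hij' : j < i := hij
      have hj : j ≠ Fin.last n := (lt_of_lt_of_le hij' (Fin.le_last i)).ne
      simp [hM, hj, hij'.ne']
    rw [Matrix.det_of_upperTriangular htri, Fin.prod_univ_castSucc]
    simp [hM, Fin.castSucc_ne_last]
  refine ⟨LinearMap.toContinuousLinearMap (Matrix.toLin' M), ?_, ?_⟩
  · rw [hasFDerivAt_pi']
    intro i
    induction i using Fin.lastCases with
    | last =>
      simp only [Fin.snoc_last]
      refine (hasFDerivAt_apply (Fin.last n) w).congr_fderiv (ContinuousLinearMap.ext fun v => ?_)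
      simp [hmul]
    | cast k =>
      simp only [Fin.snoc_castSucc]
      refine ((hasFDerivAt_apply (Fin.last n) w).mul
        (hasFDerivAt_apply (Fin.castSucc k) w)).congr_fderiv (ContinuousLinearMap.ext fun v => ?_)
      simp [hmul]
  · rw [LinearMap.det_toContinuousLinearMap, LinearMap.det_toLin', hdet]

/-- The cone chart `Φ w = (w_n · w', w_n)` is a `ℚ`-semialgebraic map on every `ℚ`-semialgebraic
set (its coordinates are the polynomials `X_n · X_k` and `X_n`). [cite: BochnakCosteRoy1998, §2.2] -/
theorem isSemialgebraicMapOn_chart {D : Set (Fin (n + 1) → ℝ)} (hD : IsSemialgebraic ℚ D) :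
    IsSemialgebraicMapOn ℚ D (fun w : Fin (n + 1) → ℝ =>
      (Fin.snoc (fun k : Fin n => w (Fin.last n) * w (Fin.castSucc k)) (w (Fin.last n)) :
        Fin (n + 1) → ℝ)) := by
  refine (isSemialgebraicMapOn_aeval hD
    (Fin.snoc (fun k : Fin n => X (Fin.last n) * X (Fin.castSucc k)) (X (Fin.last n)) :
      Fin (n + 1) → MvPolynomial (Fin (n + 1)) ℚ)).congr fun w _ => ?_
  funext j
  induction j using Fin.lastCases with
  | last => simp
  | cast k => simp

/-- **The honest pull-back of `[Cone σ, 1]` to the product domain `σ × (0,1)`** (one rule-(2) move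
along `Φ (x, t) = (t·x, t)`, Jacobian `tⁿ`): there is an honest representation `r₁` over
`σ × (0,1)` with integrand `tⁿ` there and `[Cone σ, 1] − [r₁] ∈ KZ.relations`.
[cite: KontsevichZagier2001, §1.2 rule (2)] -/
theorem exists_pullback (r : KZ.IntegralRep (n + 1)) (s : KZ.IntegralRep n) (t : KZ.IntegralRep 1)
    (hr : r.domain = {z | z (Fin.last n) ∈ Set.Ioo (0 : ℝ) 1 ∧
      (fun i => (Fin.init z : Fin n → ℝ) i / z (Fin.last n)) ∈ s.domain})
    (hr1 : ∀ z ∈ r.domain, r.integrand z = 1)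
    (htd : t.domain = Set.pi Set.univ (fun _ => Set.Ioo (0 : ℝ) 1)) :
    ∃ r₁ : KZ.IntegralRep (n + 1), r₁.domain = KZ.IntegralRep.prodDomain s t ∧
      (∀ w ∈ KZ.IntegralRep.prodDomain s t, r₁.integrand w = w (Fin.last n) ^ n) ∧
      KZ.of r - KZ.of r₁ ∈ KZ.relations := by
  set Φ : (Fin (n + 1) → ℝ) → (Fin (n + 1) → ℝ) := fun w =>
    Fin.snoc (fun k : Fin n => w (Fin.last n) * w (Fin.castSucc k)) (w (Fin.last n)) with hΦ
  -- membership in the product domain `σ × (0,1)`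
  have hmemD : ∀ w : Fin (n + 1) → ℝ, w ∈ KZ.IntegralRep.prodDomain s t ↔
      (fun i => w (Fin.castSucc i)) ∈ s.domain ∧ w (Fin.last n) ∈ Set.Ioo (0 : ℝ) 1 := by
    intro w
    rw [KZ.IntegralRep.mem_prodDomain, htd, Set.mem_univ_pi, Fin.forall_fin_one]
    exact Iff.rfl
  have hD : IsSemialgebraic ℚ (KZ.IntegralRep.prodDomain s t) :=
    KZ.IntegralRep.isSemialgebraic_prodDomain s t
  choose L hL hLdet using fun w : Fin (n + 1) → ℝ => exists_hasFDerivAt_det (n := n) w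
  -- `Φ` maps `σ × (0,1)` onto the cone
  have himage : Φ '' KZ.IntegralRep.prodDomain s t = r.domain := by
    rw [hr]
    ext z
    constructor
    · rintro ⟨w, hw, rfl⟩
      obtain ⟨hws, hw0, hw1⟩ := (hmemD w).1 hw
      refine ⟨by simpa [hΦ] using And.intro hw0 hw1, ?_⟩
      have : (fun i => (Fin.init (Φ w) : Fin n → ℝ) i / Φ w (Fin.last n)) =
          fun i => w (Fin.castSucc i) := by
        funext i
        simp [hΦ, Fin.init, mul_div_cancel_left₀ _ hw0.ne']
      rw [this]
      exact hws
    · rintro ⟨hz, hzs⟩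
      refine ⟨Fin.snoc (fun i => z (Fin.castSucc i) / z (Fin.last n)) (z (Fin.last n)),
        (hmemD _).2 ⟨by simpa [Fin.init] using hzs, by simpa using hz⟩, ?_⟩
      funext j
      induction j using Fin.lastCases with
      | last => simp [hΦ]
      | cast k => simp [hΦ, mul_div_cancel₀ _ hz.1.ne']
  -- `Φ` is injective on `σ × (0,1)`
  have hinj : Set.InjOn Φ (KZ.IntegralRep.prodDomain s t) := by
    intro w₁ hw₁ w₂ _ h
    have h0 : w₁ (Fin.last n) ≠ 0 := ((hmemD w₁).1 hw₁).2.1.ne'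
    have hlast : w₁ (Fin.last n) = w₂ (Fin.last n) := by
      simpa [hΦ] using congrFun h (Fin.last n)
    funext j
    induction j using Fin.lastCases with
    | last => exact hlast
    | cast k =>
      have hk := congrFun h (Fin.castSucc k)
      simp only [hΦ, Fin.snoc_castSucc] at hk
      rw [← hlast] at hk
      exact mul_left_cancel₀ h0 hk
  obtain ⟨r₁, h1, h2, h3⟩ := tateLifting_pullback (n + 1) r (KZ.IntegralRep.prodDomain s t) Φ L
    (fun w => w (Fin.last n) ^ n) hD (isSemialgebraicMapOn_chart hD)
    (fun w _ => (hL w).hasFDerivWithinAt) hinj himage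
    ((isSemialgebraicFunOn_aeval hD (X (Fin.last n) ^ n : MvPolynomial (Fin (n + 1)) ℚ)).congr
      fun w _ => by simp)
    (fun w hw => by
      rw [hLdet]
      exact (abs_of_nonneg (pow_nonneg ((hmemD w).1 hw).2.1.le n)).symm)
  refine ⟨r₁, h1, fun w hw => ?_, h3⟩
  rw [h2]
  dsimp only
  rw [hr1 _ (himage ▸ Set.mem_image_of_mem Φ hw), mul_one]

/-- `∫₀¹ (n+1) uⁿ du = 1`, for an honest representation over `(0,1) ⊆ ℝ¹` with integrand
`(n+1) u₀ⁿ` (transport `ℝ¹ → ℝ` along `MeasurableEquiv.funUnique`, then `integral_pow`).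
[folklore] -/
theorem value_eq_one (n : ℕ) (t : KZ.IntegralRep 1)
    (htd : t.domain = Set.pi Set.univ (fun _ => Set.Ioo (0 : ℝ) 1))
    (hti : t.integrand = fun u => ((n : ℝ) + 1) * u 0 ^ n) : t.value = 1 := by
  -- adapted from `value_monoRep` (Cruxes/DilationMove/Disproof.lean)
  have hpre : (Set.pi Set.univ fun _ : Fin 1 => Set.Ioo (0 : ℝ) 1) =
      MeasurableEquiv.funUnique (Fin 1) ℝ ⁻¹' Set.Ioo (0 : ℝ) 1 := by
    ext x
    simp [Fin.forall_fin_one, MeasurableEquiv.funUnique]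
  have h := (volume_preserving_funUnique (Fin 1) ℝ).setIntegral_preimage_emb
    (MeasurableEquiv.measurableEmbedding _) (fun x : ℝ => ((n : ℝ) + 1) * x ^ n)
    (Set.Ioo (0 : ℝ) 1)
  rw [KZ.IntegralRep.value, htd, hti, hpre]
  have h' : (fun u : Fin 1 → ℝ => ((n : ℝ) + 1) * u 0 ^ n) =
      fun u => ((n : ℝ) + 1) * (MeasurableEquiv.funUnique (Fin 1) ℝ) u ^ n := by
    funext u
    simp [MeasurableEquiv.funUnique]
  rw [h']
  refine h.trans ?_
  rw [← integral_Ioc_eq_integral_Ioo, ← intervalIntegral.integral_of_le zero_le_one,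
    intervalIntegral.integral_const_mul, integral_pow]
  have : (n : ℝ) + 1 ≠ 0 := by positivity
  field_simp
  simp

/-- **The honest representation `[(0,1), (n+1) uⁿ]`** of dimension one: domain the open unit
interval `Set.pi univ (0,1) ⊆ ℝ¹`, integrand `(n+1) u₀ⁿ` (a `ℚ`-polynomial, continuous on the
closed interval), value `1`. [folklore] -/
theorem exists_powerRep (n : ℕ) : ∃ t : KZ.IntegralRep 1,
    t.domain = Set.pi Set.univ (fun _ => Set.Ioo (0 : ℝ) 1) ∧
    (t.integrand = fun u => ((n : ℝ) + 1) * u 0 ^ n) ∧ t.value = 1 := by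
  have hE : IsSemialgebraic ℚ (Set.pi Set.univ fun _ : Fin 1 => Set.Ioo (0 : ℝ) 1) :=
    DimOne.dz_isSemialgebraic_pi_Ioo
  have hsa : IsSemialgebraicFunOn ℚ (Set.pi Set.univ fun _ : Fin 1 => Set.Ioo (0 : ℝ) 1)
      (fun u => ((n : ℝ) + 1) * u 0 ^ n) :=
    (isSemialgebraicFunOn_aeval hE (((n : MvPolynomial (Fin 1) ℚ) + 1) * X 0 ^ n)).congr
      fun u _ => by simp
  have hint : IntegrableOn (fun u : Fin 1 → ℝ => ((n : ℝ) + 1) * u 0 ^ n)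
      (Set.pi Set.univ fun _ : Fin 1 => Set.Ioo (0 : ℝ) 1) :=
    ((continuous_const.mul ((continuous_apply 0).pow n)).continuousOn.integrableOn_compact
      (isCompact_univ_pi fun _ => isCompact_Icc)).mono_set
      (Set.pi_mono fun _ _ => Set.Ioo_subset_Icc_self)
  exact ⟨⟨_, _, hE, hsa, hint⟩, rfl, rfl, value_eq_one n _ rfl rfl⟩

end Cone

/-- **CONE ENGINE** (stub 58 of line `Sketch`): for the integrand-`1` representation `r` over the
cone `Cone σ = {z ∈ ℝⁿ⁺¹ | 0 < z_n < 1, (z₀,…,z_{n−1})/z_n ∈ σ}` and the integrand-`1`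
representation `s` over `σ`, `(n+1)·[Cone σ] − [σ] ∈ KZ.relations`: one rule-(2) move along
`(x, t) ↦ (t x, t)` from `σ × (0,1)` (Jacobian `tⁿ`, `Cone.exists_pullback`), integer scaling as
integrand additivity, product splitting (`tateLifting_prodSplit`), `[(0,1), (n+1)tⁿ] ≡ [pt, 1]`
(`Fubini.cubePoly_toPoint`, `kzPeriodConjecture_dim_zero`), and unitality of `[pt, 1]`
(`KZ.mul_of_unit_sub_mem_relations`). [cite: KontsevichZagier2001, §1.2] -/
theorem tateLifting_coneEngine :
  ∀ (n : ℕ) (r : KZ.IntegralRep (n + 1)) (s : KZ.IntegralRep n),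
    r.domain = {z | z (Fin.last n) ∈ Set.Ioo (0 : ℝ) 1 ∧
      (fun i => (Fin.init z : Fin n → ℝ) i / z (Fin.last n)) ∈ s.domain} →
    (∀ z ∈ r.domain, r.integrand z = 1) → (∀ x ∈ s.domain, s.integrand x = 1) →
    ((n + 1 : ℕ) : ℤ) • KZ.of r - KZ.of s ∈ KZ.relations := by
  intro n r s hr hr1 hs1
  -- (d) the dimension-one factor `t = [(0,1), (n+1)uⁿ]`, of value `1`
  obtain ⟨t, htd, hti, htv⟩ := Cone.exists_powerRep n
  -- (a) the honest pull-back `r₁ = [σ × (0,1), tⁿ]` of `[Cone σ, 1]`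
  obtain ⟨r₁, hr₁d, hr₁i, h1⟩ := Cone.exists_pullback r s t hr hr1 htd
  -- (b) integer scaling: `[σ × (0,1), (n+1)tⁿ] − (n+1)·[σ × (0,1), tⁿ] ∈ relations`
  have h2 : KZ.of (r₁.constMul ((n + 1 : ℕ) : ℝ) (isAlgebraic_nat (n + 1))) -
      ((n + 1 : ℕ) : ℤ) • KZ.of r₁ ∈ KZ.relations := by
    rw [natCast_zsmul]
    exact r₁.of_constMul_nat_sub_nsmul_mem_relations (n + 1)
  -- (c) product splitting: `[σ × (0,1), (n+1)tⁿ] − [σ, 1]·[(0,1), (n+1)uⁿ] ∈ relations`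
  have h3 : KZ.of (r₁.constMul ((n + 1 : ℕ) : ℝ) (isAlgebraic_nat (n + 1))) -
      KZ.of s * KZ.of t ∈ KZ.relations := by
    refine tateLifting_prodSplit n 1 _ s t
      (by rw [KZ.IntegralRep.domain_constMul, hr₁d]; rfl) fun z hz => ?_
    have hzD : z ∈ KZ.IntegralRep.prodDomain s t := by
      rwa [KZ.IntegralRep.domain_constMul, hr₁d] at hz
    have hzs : (fun i => z (Fin.castAdd 1 i)) ∈ s.domain :=
      ((KZ.IntegralRep.mem_prodDomain s t z).1 hzD).1
    rw [KZ.IntegralRep.integrand_constMul, hti]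
    dsimp only
    rw [hr₁i z hzD, hs1 _ hzs, one_mul]
    push_cast
    rfl
  -- (d) `[(0,1), (n+1)uⁿ] ≡ r₀` over the point, and `r₀ ≡ [pt, 1]` (same value `1`)
  obtain ⟨r₀, -, h4⟩ := Fubini.cubePoly_toPoint 1
    (((n : MvPolynomial (Fin 1) (algebraicClosure ℚ ℝ)) + 1) * X 0 ^ n) t htd
    (fun u _ => by rw [hti]; simp)
  have hv : r₀.value = KZ.IntegralRep.unit.value := by
    rw [KZ.IntegralRep.value_unit, ← htv]
    exact (KZ.Equivalent.value_eq_holds h4).symm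
  have h5 : KZ.of r₀ - KZ.of KZ.IntegralRep.unit ∈ KZ.relations :=
    kzPeriodConjecture_dim_zero r₀ _ hv
  -- (e) the ideal property and unitality
  have h45 : KZ.of s * KZ.of t - KZ.of s * KZ.of KZ.IntegralRep.unit ∈ KZ.relations := by
    rw [← mul_sub]
    refine KZ.of_mul_mem_relations s ?_
    have h := KZ.relations.add_mem h4 h5
    rwa [sub_add_sub_cancel] at h
  have h6 := KZ.mul_of_unit_sub_mem_relations (KZ.of s)
  have key : ((n + 1 : ℕ) : ℤ) • KZ.of r - KZ.of s =
      (((n + 1 : ℕ) : ℤ) • KZ.of r - ((n + 1 : ℕ) : ℤ) • KZ.of r₁) -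
        (KZ.of (r₁.constMul ((n + 1 : ℕ) : ℝ) (isAlgebraic_nat (n + 1))) -
          ((n + 1 : ℕ) : ℤ) • KZ.of r₁) +
        (KZ.of (r₁.constMul ((n + 1 : ℕ) : ℝ) (isAlgebraic_nat (n + 1))) - KZ.of s * KZ.of t) +
        (KZ.of s * KZ.of t - KZ.of s * KZ.of KZ.IntegralRep.unit) +
        (KZ.of s * KZ.of KZ.IntegralRep.unit - KZ.of s) := by
    abel
  rw [key]
  refine add_mem (add_mem (add_mem (sub_mem ?_ h2) h3) h45) h6
  rw [← smul_sub]
  exact KZ.relations.zsmul_mem h1 _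

end Summit.KontsevichZagierPeriods.InverseLandau

end
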